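import Summits.HodgeConjecture.CorCM.Census.BlockParityLaw

/-!
# The block-parity law, II: the block parities span exactly `β − 1 − δ` dimensions on the faces; the law `|S| ≥ β − 1 − δ`

COR-CM (cell `pub-hodgecm2`), count-neutral kernel combinatorics by the binder seat b09 (gen 28; lane BLOCK-PARITY-FLOOR),
part II, sequel of `Census/BlockParityLaw.lean` (base change `rt`, blocks `blk`, block parities `par`, weight parity `wpar`,
`wdelta`, the engine `finrank_span_par_le_card`).  Theorems + two bookkeeping definitions (`wbar`, `coordOf`); no `decide`
beyond identities in `𝔽₂` with ≤ 4 variables, no certificate, no named fact, no `sorry`.  HONEST FRAMING: `HC_CM` is NOT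
proved; nothing here is a period or a headline.

SETTING (as in part I): `G` a finite group, `c : G` with `c * c = 1`; `T₀ : CMF G c` a base type (one element per place);
faces `gface Φ t t'` (`CorCM/Prior/AllgGroup1.lean`); `β = Fintype.card (Block c)`, `δ = wdelta c T₀`.

CONTENT.
* §1 **Annihilators are affine.**  If `a : Block c → 𝔽₂` kills the parity vector of every face
  (`Σ_B a_B · par(face)_B = 0`), then `ã = a ∘ blk` has vanishing second differences, hence (induction on the deviation set
  `T₀ ∖ Φ`, the induction of rfwf `l:allg`) `ã(Φ) = ã(T₀) + Σ_{s ∈ T₀∖Φ} κ(s)` with `κ(s) = ã(T₀^{(s)}) + ã(T₀)` (`affine`);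
  base-change invariance of `ã` and `rt ∘ flip = flip ∘ rt` make `κ` constant on `G` (`kappa_const`), so
  `ã(Φ) = ã(T₀) + κ₀ · wpar T₀ Φ` (`affine_wpar`): **`a` is constant, or `a = ε + w̄` with the weight parity `w̄` constant on
  blocks** (`annihilator_cases`).
* §2 **The exact rank.**  `W := span_𝔽₂ (par (faces)) ≤ 𝔽₂^{blocks}`.  Every functional killing `W` has coordinate vector
  `𝟙` or `w̄ (+𝟙)` (§1), and conversely `Σ_B` and `Σ_B w̄_B ·` kill `W` (part I `sum_par_gface`, `wlin_gface`); with
  `dim W + dim W^⊥ = β` (`Subspace.finrank_add_finrank_dualAnnihilator_eq`):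
  **`finrank_span_par_gfaceSet_add : dim_𝔽₂ W + 1 + δ = β`** — the block parities detect EXACTLY `β − 1 − δ` independent
  conditions on the face lattice, no more (the «divided parities» of some `2`-groups — `Q₈`, `Q₁₆`, `ℤ/4×ℤ/2` with `c ∈ 2G`, … —
  are invisible to them).
* §3 **THE BLOCK-PARITY LAW** (`card_block_le_card_add`): for every finite family `S ⊆ ℤ[types]` and every submodule `P₀` killed
  by `par` (the pairs, part I `par_pair`) with `faces ⊆ P₀ + ℤ[G]·S`:  **`β ≤ |S| + 1 + δ`**, i.e. `|S| ≥ β − 1 − δ` — for EVERY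
  `(G, c)`, `|G| ≡ 0 (mod 4)` included, no census, no certificate.  DICTIONARY (cited, as in `Census/OddDegreeParityLaw.lean`):
  `μ(G, c) ≥ #{isogeny classes of simple CM abelian varieties split by F} − 1 − δ` [cite: Milne1999, Prop. 2.1, p. 54;
  Pohlmann1968, Thm 1].  Numerically (seat folder `py/lawcheck.py`, every `(G, c)` with `|G| ≤ 20`): equal to André-3's `μ` on
  `ℤ/6 … ℤ/20` (`1,1,3,5,9,15,29,51`), `ℤ/2×ℤ/10 (54)`, `D₂₀ (66)`, `Dic₅ (51)`, `D₁₂ (8)`, `Dic₃ (5)`, `ℤ/6×ℤ/2 (6)`, `ℤ/6×ℤ/3 (31)`,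
  `(ℤ/2)³ (3)`, `D₈ (2)`, `(ℤ/2)⁴ (28)`, `D₁₆ (22)`, `ℤ/4×ℤ/4 (18)`, `D₄∘ℤ/4 (20)`; below `μ` only on `Q₈ (0 < 2)`, `Q₁₆ (14 < 16)`,
  `SD₁₆ (18 < 19)`, `M₁₆ (16 < 17)`, `ℤ/4×ℤ/2, c ∈ 2G (1 < 2)`, `ℤ/8×ℤ/2, c = (4,0) (16 < 17)`, `ℤ/4⋊ℤ/4, c = y² (17 < 18)`,
  `Q₈×ℤ/2, c = −1 (16 < 18)`.

## References
* [Pohlmann1968] H. Pohlmann, Algebraic cycles on abelian varieties of complex multiplication type, Ann. of Math. 88 (1968), Thm 1.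
* [Milne1999] J. S. Milne, Lefschetz motives and the Tate conjecture, Compositio Math. 117 (1999), Prop. 2.1, p. 54.
-/

namespace Summit.HodgeConjecture.CorCM.Census.BlockParity

open Finset
open Summit.HodgeConjecture.CorCM.Prior.AllgGroup.RfwfAllgGroup

noncomputable section

variable {G : Type*} [Group G] [Fintype G] [DecidableEq G] (c : G)

/-! ## §0 Flips commute and are involutions (abstract `G`) -/

/-- Flips at two places commute. [folklore] -/
theorem oflipCM_oflipCM_comm (hc2 : c * c = 1) (t t' : G) (Ψ : CMF G c) :
    oflipCM c hc2 t (oflipCM c hc2 t' Ψ) = oflipCM c hc2 t' (oflipCM c hc2 t Ψ) := by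
  apply Subtype.ext
  change oflip c t (oflip c t' Ψ.1) = oflip c t' (oflip c t Ψ.1)
  simp only [oflip, symmDiff_assoc, symmDiff_comm (orb c t') (orb c t)]

/-- Flipping twice at the same place is the identity. [folklore] -/
theorem oflipCM_oflipCM_self (hc2 : c * c = 1) (t : G) (Ψ : CMF G c) : oflipCM c hc2 t (oflipCM c hc2 t Ψ) = Ψ := by
  apply Subtype.ext
  change oflip c t (oflip c t Ψ.1) = Ψ.1
  simp only [oflip, symmDiff_symmDiff_cancel_right]

/-- Two distinct members of a CM type lie in distinct places. [folklore] -/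
theorem notMem_orb_of_mem {T₀ : CMF G c} {s s' : G} (hs : s ∈ T₀.1) (hs' : s' ∈ T₀.1) (hne : s' ≠ s) : s' ∉ orb c s := by
  rw [mem_orb]
  rintro (h | h)
  · exact hne h
  · exact (T₀.2 s).mp hs (h ▸ hs')

/-! ## §1 Annihilators of the face parities are affine -/

section Affine

variable {c}
variable (hc2 : c * c = 1) {a : Block c → ZMod 2}

/-- `Σ_B a_B · par([Ψ]·n)_B = n · a(blk Ψ)`. [folklore] -/
theorem sum_mul_par_single (a : Block c → ZMod 2) (Ψ : CMF G c) (n : ℤ) :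
    ∑ B, a B * par c (Finsupp.single Ψ n) B = (n : ZMod 2) * a (blk c Ψ) := by
  simp_rw [par_single_apply, mul_ite, mul_zero]
  rw [Finset.sum_ite_eq, if_pos (Finset.mem_univ _), mul_comm]

/-- **Second differences of an annihilator vanish**: `ã(Φ^{(tt')}) = ã(Φ) + ã(Φ^{(t)}) + ã(Φ^{(t')})` in `𝔽₂`. [folklore] -/
theorem second_diff (ha : ∀ (Φ : CMF G c) (t t' : G), t' ∉ orb c t → ∑ B, a B * par c (gface c hc2 Φ t t') B = 0)
    (Φ : CMF G c) {t t' : G} (ht' : t' ∉ orb c t) :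
    a (blk c (oflipCM c hc2 t (oflipCM c hc2 t' Φ))) =
      a (blk c Φ) + a (blk c (oflipCM c hc2 t Φ)) + a (blk c (oflipCM c hc2 t' Φ)) := by
  have h := ha Φ t t' ht'
  unfold gface at h
  simp only [map_add, map_sub, Pi.add_apply, Pi.sub_apply, mul_add, mul_sub, Finset.sum_add_distrib,
    Finset.sum_sub_distrib, sum_mul_par_single, Int.cast_one, one_mul] at h
  have key : ∀ x y z w : ZMod 2, x + y - z - w = 0 → y = x + z + w := by decide
  exact key _ _ _ _ h

/-- **Annihilators are affine in the deviation set**: `ã(Φ) = ã(T₀) + Σ_{s ∈ T₀∖Φ} (ã(T₀^{(s)}) + ã(T₀))`. [folklore] -/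
theorem affine (ha : ∀ (Φ : CMF G c) (t t' : G), t' ∉ orb c t → ∑ B, a B * par c (gface c hc2 Φ t t') B = 0)
    (T₀ Φ : CMF G c) :
    a (blk c Φ) = a (blk c T₀) + ∑ s ∈ T₀.1 \ Φ.1, (a (blk c (oflipCM c hc2 s T₀)) + a (blk c T₀)) := by
  suffices h : ∀ (n : ℕ) (Φ : CMF G c), (T₀.1 \ Φ.1).card = n →
      a (blk c Φ) = a (blk c T₀) + ∑ s ∈ T₀.1 \ Φ.1, (a (blk c (oflipCM c hc2 s T₀)) + a (blk c T₀)) from h _ Φ rfl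
  intro n
  induction n using Nat.strong_induction_on with
  | h n ih =>
  intro Φ hn
  rcases n with _ | (_ | m)
  · rw [eq_of_dev_empty c (Finset.card_eq_zero.mp hn), Finset.sdiff_self, Finset.sum_empty, add_zero]
  · obtain ⟨s, hs⟩ := Finset.card_eq_one.mp hn
    rw [hs, Finset.sum_singleton, eq_oflip_of_dev_singleton c hc2 hs]
    have key : ∀ x y : ZMod 2, x = y + (x + y) := by decide
    exact key _ _
  · -- two distinct deviation places `s ≠ s'`
    have hcard : 1 < (T₀.1 \ Φ.1).card := by omega
    obtain ⟨s, hs, s', hs', hne⟩ := Finset.one_lt_card.mp hcard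
    obtain ⟨hsT, hsΦ⟩ := Finset.mem_sdiff.mp hs
    obtain ⟨hs'T, hs'Φ⟩ := Finset.mem_sdiff.mp hs'
    have hss' : s' ∉ orb c s := notMem_orb_of_mem c hsT hs'T (Ne.symm hne)
    -- `Ψ = Φ^{(s)(s')}` and its three neighbours
    set Ψ := oflipCM c hc2 s (oflipCM c hc2 s' Φ) with hΨ
    have e1 : oflipCM c hc2 s Ψ = oflipCM c hc2 s' Φ := by rw [hΨ, oflipCM_oflipCM_self]
    have e2 : oflipCM c hc2 s' Ψ = oflipCM c hc2 s Φ := by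
      rw [hΨ, oflipCM_oflipCM_comm c hc2 s s', oflipCM_oflipCM_self]
    have e3 : oflipCM c hc2 s (oflipCM c hc2 s' Ψ) = Φ := by rw [e2, oflipCM_oflipCM_self]
    -- deviation sets
    have d1 : T₀.1 \ (oflipCM c hc2 s' Φ).1 = (T₀.1 \ Φ.1).erase s' := dev_oflip c hc2 hs'T hs'Φ
    have d2 : T₀.1 \ (oflipCM c hc2 s Φ).1 = (T₀.1 \ Φ.1).erase s := dev_oflip c hc2 hsT hsΦ
    have hsΦ' : s ∉ (oflipCM c hc2 s' Φ).1 := by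
      have : s ∈ T₀.1 \ (oflipCM c hc2 s' Φ).1 := by rw [d1]; exact Finset.mem_erase.mpr ⟨hne, hs⟩
      exact (Finset.mem_sdiff.mp this).2
    have d0 : T₀.1 \ Ψ.1 = ((T₀.1 \ Φ.1).erase s').erase s := by rw [hΨ, dev_oflip c hc2 hsT hsΦ', d1]
    have c1 : ((T₀.1 \ Φ.1).erase s').card = m + 1 := by rw [Finset.card_erase_of_mem hs']; omega
    have c2 : ((T₀.1 \ Φ.1).erase s).card = m + 1 := by rw [Finset.card_erase_of_mem hs]; omega
    have hs0 : s ∈ (T₀.1 \ Φ.1).erase s' := Finset.mem_erase.mpr ⟨hne, hs⟩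
    have c0 : (((T₀.1 \ Φ.1).erase s').erase s).card = m := by rw [Finset.card_erase_of_mem hs0, c1]; omega
    have i0 := ih m (by omega) Ψ (by rw [d0, c0])
    have i1 := ih (m + 1) (by omega) (oflipCM c hc2 s' Φ) (by rw [d1, c1])
    have i2 := ih (m + 1) (by omega) (oflipCM c hc2 s Φ) (by rw [d2, c2])
    rw [d0] at i0; rw [d1] at i1; rw [d2] at i2
    have h2 := second_diff hc2 ha Ψ hss'
    rw [e3, e1, e2, i0, i1, i2] at h2
    rw [h2]
    -- bookkeeping of the three sums
    set κ : G → ZMod 2 := fun x => a (blk c (oflipCM c hc2 x T₀)) + a (blk c T₀) with hκ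
    have t1 : ∑ x ∈ (T₀.1 \ Φ.1).erase s', κ x = ∑ x ∈ ((T₀.1 \ Φ.1).erase s').erase s, κ x + κ s :=
      (Finset.sum_erase_add _ _ hs0).symm
    have t2 : ∑ x ∈ T₀.1 \ Φ.1, κ x = ∑ x ∈ (T₀.1 \ Φ.1).erase s', κ x + κ s' := (Finset.sum_erase_add _ _ hs').symm
    have t3 : ∑ x ∈ T₀.1 \ Φ.1, κ x = ∑ x ∈ (T₀.1 \ Φ.1).erase s, κ x + κ s := (Finset.sum_erase_add _ _ hs).symm
    have key : ∀ A X K1 K2 S1 S S3 : ZMod 2, S1 = X + K1 → S = S1 + K2 → S = S3 + K1 →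
        A + X + (A + S1) + (A + S3) = A + S := by decide
    exact key _ _ _ _ _ _ _ t1 t2 t3

/-- **First differences of an annihilator depend only on the place**: `ã(Φ^{(t)}) + ã(Φ) = ã(T₀^{(t)}) + ã(T₀)`.
[folklore] -/
theorem first_diff (ha : ∀ (Φ : CMF G c) (t t' : G), t' ∉ orb c t → ∑ B, a B * par c (gface c hc2 Φ t t') B = 0)
    (T₀ Φ : CMF G c) (t : G) :
    a (blk c (oflipCM c hc2 t Φ)) + a (blk c Φ) = a (blk c (oflipCM c hc2 t T₀)) + a (blk c T₀) := by
  suffices h : ∀ s ∈ T₀.1, ∀ Φ : CMF G c,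
      a (blk c (oflipCM c hc2 s Φ)) + a (blk c Φ) = a (blk c (oflipCM c hc2 s T₀)) + a (blk c T₀) by
    by_cases ht : t ∈ T₀.1
    · exact h t ht Φ
    · have hct : c * t ∈ T₀.1 := by
        by_contra hh; exact ht ((T₀.2 t).mpr hh)
      rw [← oflipCM_cmul c hc2 t Φ, ← oflipCM_cmul c hc2 t T₀]
      exact h (c * t) hct Φ
  intro s hsT Φ
  rw [affine hc2 ha T₀ (oflipCM c hc2 s Φ), affine hc2 ha T₀ Φ]
  by_cases hsΦ : s ∈ Φ.1
  · rw [dev_oflip_of_mem c hc2 hsT hsΦ, Finset.sum_insert (fun h => (Finset.mem_sdiff.mp h).2 hsΦ)]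
    have key : ∀ A K S : ZMod 2, A + (K + S) + (A + S) = K := by decide
    exact key _ _ _
  · rw [dev_oflip c hc2 hsT hsΦ, ← Finset.sum_erase_add _ _ (Finset.mem_sdiff.mpr ⟨hsT, hsΦ⟩)]
    have key : ∀ A K S : ZMod 2, A + S + (A + (S + K)) = K := by decide
    exact key _ _ _

/-- **First differences of an annihilator are constant** (base-change invariance + `rt ∘ flip = flip ∘ rt` + transitivity of
`G` on places). [folklore] -/
theorem kappa_const (ha : ∀ (Φ : CMF G c) (t t' : G), t' ∉ orb c t → ∑ B, a B * par c (gface c hc2 Φ t t') B = 0)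
    (T₀ : CMF G c) (t t' : G) :
    a (blk c (oflipCM c hc2 t T₀)) + a (blk c T₀) = a (blk c (oflipCM c hc2 t' T₀)) + a (blk c T₀) := by
  have h := first_diff hc2 ha T₀ (rt c (t'⁻¹ * t) T₀) (t * (t'⁻¹ * t)⁻¹)
  rw [← rt_oflipCM, blk_rt, blk_rt] at h
  have e : t * (t'⁻¹ * t)⁻¹ = t' := by group
  rw [e] at h
  exact h

/-- **Annihilators are affine in the weight parity**: `ã(Φ) = ã(T₀) + wpar T₀ Φ · κ₀`. [folklore] -/
theorem affine_wpar (ha : ∀ (Φ : CMF G c) (t t' : G), t' ∉ orb c t → ∑ B, a B * par c (gface c hc2 Φ t t') B = 0)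
    (T₀ Φ : CMF G c) :
    a (blk c Φ) = a (blk c T₀) + wpar c T₀ Φ * (a (blk c (oflipCM c hc2 1 T₀)) + a (blk c T₀)) := by
  rw [affine hc2 ha T₀ Φ, Finset.sum_congr rfl (fun s _ => kappa_const hc2 ha T₀ s 1), Finset.sum_const, nsmul_eq_mul]
  rfl

/-- **The dichotomy.**  An annihilator of the face parities is constant on blocks, or it is `ε + (weight parity)` AND the weight
parity is constant on blocks. [folklore] -/
theorem annihilator_cases (ha : ∀ (Φ : CMF G c) (t t' : G), t' ∉ orb c t → ∑ B, a B * par c (gface c hc2 Φ t t') B = 0)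
    (T₀ : CMF G c) :
    (∀ B, a B = a (blk c T₀)) ∨
      ((∀ (Q : G) (Ψ : CMF G c), wpar c T₀ (rt c Q Ψ) = wpar c T₀ Ψ) ∧
        ∀ Ψ : CMF G c, a (blk c Ψ) = a (blk c T₀) + wpar c T₀ Ψ) := by
  have hκ : ∀ x : ZMod 2, x = 0 ∨ x = 1 := by decide
  rcases hκ (a (blk c (oflipCM c hc2 1 T₀)) + a (blk c T₀)) with h0 | h1
  · left
    intro B
    obtain ⟨Ψ, rfl⟩ := blk_surjective c B
    rw [affine_wpar hc2 ha T₀ Ψ, h0, mul_zero, add_zero]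
  · right
    have hΨ : ∀ Ψ : CMF G c, a (blk c Ψ) = a (blk c T₀) + wpar c T₀ Ψ := fun Ψ => by
      rw [affine_wpar hc2 ha T₀ Ψ, h1, mul_one]
    refine ⟨fun Q Ψ => ?_, hΨ⟩
    have e1 := hΨ (rt c Q Ψ)
    have e2 := hΨ Ψ
    rw [blk_rt] at e1
    have key : ∀ x A w w' : ZMod 2, x = A + w → x = A + w' → w = w' := by decide
    exact key _ _ _ _ e1 e2

end Affine

/-! ## §2 The exact rank of the block parities on the faces -/

section Rank

variable (hc2 : c * c = 1)

/-- The weight parity descended to blocks (through a representative; meaningful when it is constant on blocks). [folklore] -/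
def wbar (T₀ : CMF G c) (B : Block c) : ZMod 2 := wpar c T₀ (Quotient.out B)

/-- Under invariance, `wbar (blk Ψ) = wpar Ψ`. [folklore] -/
theorem wbar_blk (T₀ : CMF G c) (hW : ∀ (Q : G) (Ψ : CMF G c), wpar c T₀ (rt c Q Ψ) = wpar c T₀ Ψ) (Ψ : CMF G c) :
    wbar c T₀ (blk c Ψ) = wpar c T₀ Ψ := by
  have h : blk c (Quotient.out (blk c Ψ)) = blk c Ψ := Quotient.out_eq _
  obtain ⟨Q, hQ⟩ := exists_rt_eq_of_blk_eq c h
  unfold wbar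
  rw [← hW Q (Quotient.out (blk c Ψ)), hQ]

/-- `Σ_B w̄_B · par(y)_B = wlin y` under invariance. [folklore] -/
theorem sum_wbar_mul_par (T₀ : CMF G c) (hW : ∀ (Q : G) (Ψ : CMF G c), wpar c T₀ (rt c Q Ψ) = wpar c T₀ Ψ)
    (y : CMF G c →₀ ℤ) : ∑ B, wbar c T₀ B * par c y B = wlin c T₀ y := by
  induction y using Finsupp.induction_linear with
  | zero => simp
  | add f g hf hg => simp only [map_add, Pi.add_apply, mul_add, Finset.sum_add_distrib, hf, hg]
  | single Ψ n => rw [sum_mul_par_single, wlin_single, wbar_blk c T₀ hW]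

/-- **Coordinates of a functional** on `𝔽₂^{blocks}`: `coordOf φ B = φ(e_B)`. [folklore] -/
def coordOf : Module.Dual (ZMod 2) (Block c → ZMod 2) →ₗ[ZMod 2] (Block c → ZMod 2) where
  toFun φ B := φ (fun j => if B = j then 1 else 0)
  map_add' φ ψ := by funext B; rfl
  map_smul' r φ := by funext B; rfl

/-- A functional is the dot product with its coordinates. [folklore] -/
theorem apply_eq_sum_coordOf (φ : Module.Dual (ZMod 2) (Block c → ZMod 2)) (x : Block c → ZMod 2) :
    φ x = ∑ B, coordOf c φ B * x B := by
  rw [LinearMap.pi_apply_eq_sum_univ φ x]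
  refine Finset.sum_congr rfl fun B _ => ?_
  rw [smul_eq_mul, mul_comm]; rfl

/-- `coordOf` is injective. [folklore] -/
theorem coordOf_injective : Function.Injective (coordOf c) := by
  intro φ ψ h
  apply LinearMap.ext
  intro x
  rw [apply_eq_sum_coordOf, apply_eq_sum_coordOf, h]

/-- The generators of the relation space: `𝟙`, and `w̄` when the weight parity is constant on blocks. [folklore] -/
def relGens (T₀ : CMF G c) : Finset (Block c → ZMod 2) := by
  classical
  exact if ∀ (Q : G) (Ψ : CMF G c), wpar c T₀ (rt c Q Ψ) = wpar c T₀ Ψ then {fun _ => 1, wbar c T₀} else {fun _ => 1}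

/-- `|relGens| ≤ 1 + δ`. [folklore] -/
theorem card_relGens_le (T₀ : CMF G c) : (relGens c T₀).card ≤ 1 + wdelta c T₀ := by
  classical
  unfold relGens
  split_ifs with h
  · rw [wdelta_eq_one c h]; exact Finset.card_le_two
  · rw [wdelta_eq_zero c h, Finset.card_singleton]

/-- **Every functional killing the face parities has coordinates in the relation space.** [folklore] -/
theorem coordOf_mem_span_relGens (T₀ : CMF G c) {φ : Module.Dual (ZMod 2) (Block c → ZMod 2)}
    (hφ : φ ∈ (Submodule.span (ZMod 2) (par c '' gfaceSet G c hc2)).dualAnnihilator) :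
    coordOf c φ ∈ Submodule.span (ZMod 2) (relGens c T₀ : Set (Block c → ZMod 2)) := by
  classical
  have ha : ∀ (Φ : CMF G c) (t t' : G), t' ∉ orb c t → ∑ B, coordOf c φ B * par c (gface c hc2 Φ t t') B = 0 := by
    intro Φ t t' ht'
    rw [← apply_eq_sum_coordOf]
    exact (Submodule.mem_dualAnnihilator φ).mp hφ _ (Submodule.subset_span ⟨_, ⟨Φ, t, t', ht', rfl⟩, rfl⟩)
  have h1 : (fun _ : Block c => (1 : ZMod 2)) ∈ Submodule.span (ZMod 2) (relGens c T₀ : Set (Block c → ZMod 2)) := by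
    apply Submodule.subset_span
    unfold relGens; split_ifs <;> simp
  rcases annihilator_cases hc2 ha T₀ with hconst | ⟨hW, hw⟩
  · have e : coordOf c φ = coordOf c φ (blk c T₀) • fun _ : Block c => (1 : ZMod 2) := by
      funext B; rw [Pi.smul_apply, smul_eq_mul, mul_one]; exact hconst B
    rw [e]
    exact Submodule.smul_mem _ _ h1
  · have hw' : wbar c T₀ ∈ Submodule.span (ZMod 2) (relGens c T₀ : Set (Block c → ZMod 2)) := by
      apply Submodule.subset_span
      unfold relGens; rw [if_pos hW]; simp
    have e : coordOf c φ = (coordOf c φ (blk c T₀) • fun _ : Block c => (1 : ZMod 2)) + wbar c T₀ := by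
      funext B
      obtain ⟨Ψ, rfl⟩ := blk_surjective c B
      rw [Pi.add_apply, Pi.smul_apply, smul_eq_mul, mul_one, wbar_blk c T₀ hW]
      exact hw Ψ
    rw [e]
    exact Submodule.add_mem _ (Submodule.smul_mem _ _ h1) hw'

/-- **Upper bound on the relations**: `dim W^⊥ ≤ 1 + δ`. [folklore] -/
theorem finrank_dualAnnihilator_le (T₀ : CMF G c) :
    Module.finrank (ZMod 2) (Submodule.span (ZMod 2) (par c '' gfaceSet G c hc2)).dualAnnihilator ≤ 1 + wdelta c T₀ := by
  classical
  set A := (Submodule.span (ZMod 2) (par c '' gfaceSet G c hc2)).dualAnnihilator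
  have hmap : A.map (coordOf c) ≤ Submodule.span (ZMod 2) (relGens c T₀ : Set (Block c → ZMod 2)) := by
    rintro _ ⟨φ, hφ, rfl⟩
    exact coordOf_mem_span_relGens c hc2 T₀ hφ
  calc Module.finrank (ZMod 2) A = Module.finrank (ZMod 2) (A.map (coordOf c)) :=
        (Submodule.equivMapOfInjective _ (coordOf_injective c) A).finrank_eq
    _ ≤ Module.finrank (ZMod 2) (Submodule.span (ZMod 2) (relGens c T₀ : Set (Block c → ZMod 2))) :=
        Submodule.finrank_mono hmap
    _ ≤ (relGens c T₀).card := finrank_span_finset_le_card _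
    _ ≤ 1 + wdelta c T₀ := card_relGens_le c T₀

/-- **`β ≤ dim_𝔽₂ span(par(faces)) + 1 + δ`.** [folklore] -/
theorem card_block_le_finrank_add (T₀ : CMF G c) :
    Fintype.card (Block c) ≤
      Module.finrank (ZMod 2) (Submodule.span (ZMod 2) (par c '' gfaceSet G c hc2)) + 1 + wdelta c T₀ := by
  have h := Subspace.finrank_add_finrank_dualAnnihilator_eq (Submodule.span (ZMod 2) (par c '' gfaceSet G c hc2))
  rw [Module.finrank_fintype_fun_eq_card] at h
  have h2 := finrank_dualAnnihilator_le c hc2 T₀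
  omega

/-! ## §3 The block-parity law -/

/-- **THE BLOCK-PARITY LAW.**  For every finite group `G` with an involution `c` (central in the application, so that `par`
kills the pairs), every base type `T₀`, every submodule `P₀ ⊆ ℤ[types]` killed by the block parities and every finite family
`S ⊆ ℤ[types]` with `faces ⊆ P₀ + ℤ[G]·S`:  `β(G,c) ≤ |S| + 1 + δ`, i.e. **`|S| ≥ β − 1 − δ`**.
[cite: Pohlmann1968, Thm 1; Milne1999, Prop. 2.1, p. 54] (dictionary); the law itself: [folklore] kernel census of this cell. -/
theorem card_block_le_card_add (T₀ : CMF G c) (S : Finset (CMF G c →₀ ℤ)) (P₀ : Submodule ℤ (CMF G c →₀ ℤ))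
    (hP₀ : ∀ y ∈ P₀, par c y = 0) (hS : gfaceSet G c hc2 ⊆ ↑(P₀ ⊔ Submodule.span ℤ (translates c S))) :
    Fintype.card (Block c) ≤ S.card + 1 + wdelta c T₀ := by
  have h1 := card_block_le_finrank_add c hc2 T₀
  have h2 := finrank_span_par_le_card c S P₀ hP₀ hS
  omega

end Rank

end

end Summit.HodgeConjecture.CorCM.Census.BlockParity
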